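import Literature.IUT.HodgeArakelov.LabelClassesOfCusps

/-!
# [IUTchII] Def 2.3 (v): the EXACT INHABITATION CONDITION of the `𝔽^±_l`-torsor interface `FlTorsorStructure`

Mochizuki, *Inter-universal Teichmüller theory II*, §2, Definition 2.3 (v), kurims manuscript (Dec. 2020) p. 69
[claim: Mochizuki2012, status: disputed] (IUTchII §2 Def 2.3 (v), kurims p.69): "`LabCusp^±(Π̂^±_v)` is equipped
with a natural `𝔽^±_l`-torsor structure [cf. [IUTchI], Def. 6.1 (iii)] … the natural action of `Π_⊇/Π_⊆` on `Π_⊆`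
preserves this `𝔽^±_l`-torsor structure; we have a natural outer isomorphism `Π̂^cor_v/Π̂^±_v ≅ 𝔽_l^{⋊±}`".
Record-only vocabulary under the claim key `Mochizuki2012` (D-0012, disputed); abc-iut cell, layer L6,
NON-VACUITY CERTIFICATE (abc-iut-L6-lead §F v1.18p «NV-L6 WAVE», row `NV-L6/FlTorsorStructure`; inhabitation
census abc-iut-w5-d114 v3 §A: ZERO producers) for abc-iut-L6-t1's interface
`Literature.IUT.HodgeArakelov.FlTorsorStructure C` (`LabelClassesOfCusps.lean`, p407174), over which [IUTchII]
Cor. 3.5 (i) (`BadPrimeGaussianMonoids.conjAct_*`, abc-iut-w4-d004), Cor. 4.5 (iii) / 4.6 (iii) and the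
`Def23_structures` existence predicate are typed.

What the kernel says (this file; proof-only: no `def`, no instance, no named fact; nothing asserted about print):

* `FlTorsorStructure.nonempty_of_isos` — the interface is inhabited over `(W, C)` AS SOON AS the two printed
  iso-data exist: an outer isomorphism `Π̂^cor_v/Π̂^±_v ≅ 𝔽_l^{⋊±}` and a chart `LabCusp^±(Π̂^±_v) ≅ 𝔽_l`; the
  action field `conjAct` is then DEFINED through the chart by the affine formula `x ↦ ±x + a` of the law
  `conjAct_chart`, which therefore holds by construction.
* `FlTorsorStructure.nonempty_iff` — conversely any inhabitant supplies the two iso-data, so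
  `Nonempty (FlTorsorStructure C) ↔ Nonempty (Π̂^cor_v/Π̂^±_v ≃* 𝔽_l^{⋊±}) ∧ Nonempty (LabCusp^±(Π̂^±_v) ≃ 𝔽_l)`:
  the EXACT inhabitation condition. READING NOTE (typing, not a defect claim): the interface does NOT tie
  `conjAct` to the conjugation action of `Π̂^cor_v` on cuspidal inertia subgroups — `conjAct` is free data
  constrained only through the chart — so the genuine content «the natural action … preserves this torsor
  structure» lives in the CHOICE of `conjAct` := conjugation at a genuine `(W, C)`, i.e. in the producers of the
  two iso-data (NV rows `PlusMinusTower` — abc-iut-w5-d063 — and `CuspidalInertiaData`/`LabCuspStructure` —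
  abc-iut-w5-d028; the GENUINE instance = [IUTchI] Def. 6.1 (iii) cusp labels over the L5 Θ±-bridge data,
  MERGE-MAP). HONEST LABEL: this is a REDUCTION certificate (no model is built here); it is neither a genuine
  nor a degenerate witness and discharges nothing. Nothing here bears on [IUTchIII] Cor. 3.12; no side is taken.
-/

namespace Literature.IUT.HodgeArakelov

universe u

namespace FlTorsorStructure

open Literature.IUT.HodgeTheaters

variable {S : BadPlaceSetting.{u}} {P : TopGroup.{u}} {T : TemperedCoverings S P} {W : PlusMinusTower T}
  (C : CuspidalInertiaData W)

/-- **IUTchII:Def2.3(v)** (kurims p. 69) — NON-VACUITY BY REDUCTION: an outer isomorphism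
`Π̂^cor_v/Π̂^±_v ≅ 𝔽_l^{⋊±}` and a chart `LabCusp^±(Π̂^±_v) ≅ 𝔽_l` already give an `FlTorsorStructure`, the action
on label classes being READ OFF the chart by the affine law `x ↦ ±x + a` (so `conjAct_chart` holds by
`Equiv.apply_symm_apply`). [claim: Mochizuki2012, status: disputed] (IUTchII §2 Def 2.3 (v), kurims p.69) -/
theorem nonempty_of_isos (q : W.Corhat ⧸ W.pmHat ≃* FlPM S.l) (c : LabCuspPM C W.pmHat W.pmHat ≃ ZMod S.l) :
    Nonempty (FlTorsorStructure C) :=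
  ⟨{ chart := c
     quotIso := q
     conjAct := fun g t =>
       c.symm (Multiplicative.toAdd (q (QuotientGroup.mk g)).left + ((q (QuotientGroup.mk g)).right : ℤ) * c t)
     conjAct_chart := fun _ _ => c.apply_symm_apply _ }⟩

/-- **IUTchII:Def2.3(v)** (kurims p. 69) — the EXACT INHABITATION CONDITION of the interface:
`FlTorsorStructure C` is inhabited iff the two printed iso-data exist (`Π̂^cor_v/Π̂^±_v ≅ 𝔽_l^{⋊±}` and
`|LabCusp^±(Π̂^±_v)| = l` as a chart). In particular the fields `conjAct`/`conjAct_chart` impose no further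
constraint (reading note in the module docstring). [claim: Mochizuki2012, status: disputed] (IUTchII §2 Def 2.3 (v), kurims p.69) -/
theorem nonempty_iff :
    Nonempty (FlTorsorStructure C) ↔
      Nonempty (W.Corhat ⧸ W.pmHat ≃* FlPM S.l) ∧ Nonempty (LabCuspPM C W.pmHat W.pmHat ≃ ZMod S.l) :=
  ⟨fun ⟨F⟩ => ⟨⟨F.quotIso⟩, ⟨F.chart⟩⟩, fun ⟨⟨q⟩, ⟨c⟩⟩ => nonempty_of_isos C q c⟩

/-- **IUTchII:Def2.3(v)** (kurims p. 69) — any two inhabitants have charts differing by a PERMUTATION of `𝔽_l`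
and quotient isomorphisms differing by an AUTOMORPHISM of `𝔽_l^{⋊±}` (bookkeeping: the interface pins neither the
chart nor the outer isomorphism; print: "natural outer isomorphism", [IUTchI] Def. 6.1 (iii) "well-defined up to
…"). [claim: Mochizuki2012, status: disputed] (IUTchII §2 Def 2.3 (v), kurims p.69) -/
theorem chart_trans_symm_chart (F F' : FlTorsorStructure C) :
    ∃ (σ : Equiv.Perm (ZMod S.l)) (α : FlPM S.l ≃* FlPM S.l),
      (∀ t, F'.chart t = σ (F.chart t)) ∧ ∀ x, F'.quotIso x = α (F.quotIso x) :=
  ⟨F.chart.symm.trans F'.chart, F.quotIso.symm.trans F'.quotIso,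
    fun t => by simp, fun x => by simp⟩

end FlTorsorStructure

end Literature.IUT.HodgeArakelov
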